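import Mathlib
import HarnessLib

/-!
# The dual of a product: `(A × B)^ ≅ Â × B̂` (Deitmar–Echterhoff, Exercise 3.5)

Topic `Topology/Algebra`; namespace `Literature.Topology.Algebra.ProdDual`. For monoids `A`, `B` carrying topologies
the Pontryagin dual of `A × B` is the product of the duals:

* `split : PontryaginDual (A × B) →* PontryaginDual A × PontryaginDual B`, `χ ↦ (χ ∘ inl, χ ∘ inr)`;
* `glue : PontryaginDual A × PontryaginDual B →* PontryaginDual (A × B)`, `(φ, ψ) ↦ ((a, b) ↦ φ a · ψ b)`;
* `prodEquiv : PontryaginDual (A × B) ≃* PontryaginDual A × PontryaginDual B` — "`\widehat{A × B} =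
  \widehat{A} × \widehat{B}`" [DeitmarEchterhoff2014, Exercise 3.5] as a group isomorphism (the exercise is
  stated for LCA groups and includes the topology; the algebraic isomorphism recorded here needs neither),
  with the unfoldings `prodEquiv_apply_fst/snd`, `prodEquiv_symm_apply`, and the splitting identity
  `χ (a, b) = χ (a, 1) * χ (1, b)` (`apply_eq_mul`).

Mathlib has `ContinuousMonoidHom.prod / prodMap / coprod / inl / inr` and the functor `PontryaginDual.map`
but not this equivalence; the HodgeCM PerL cell (`pub-hodgecm`) describes the characters of its model tori
`V × U(1)` of given central weight through it. Filed under the LEAN-IN-TREE rule by seat pv15-g6.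

## References

* A. Deitmar, S. Echterhoff, *Principles of Harmonic Analysis*, 2nd ed. (2014), Ch. 3, Exercise 3.5
  [DeitmarEchterhoff2014].
-/

noncomputable section

open _root_.Topology

namespace Literature.Topology.Algebra

namespace ProdDual

variable {A B : Type*} [Monoid A] [TopologicalSpace A] [Monoid B] [TopologicalSpace B]

/-- A character of `A × B` splits: `χ (a, b) = χ (a, 1) * χ (1, b)`. [folklore] -/
theorem apply_eq_mul (χ : PontryaginDual (A × B)) (a : A) (b : B) : χ (a, b) = χ (a, 1) * χ (1, b) := by
  rw [← map_mul, Prod.mk_mul_mk, mul_one, one_mul]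

/-- **Splitting** `χ ↦ (χ ∘ inl, χ ∘ inr)`. [folklore] -/
def split : PontryaginDual (A × B) →* PontryaginDual A × PontryaginDual B :=
  MonoidHom.prod (PontryaginDual.map (ContinuousMonoidHom.inl A B)).toMonoidHom
    (PontryaginDual.map (ContinuousMonoidHom.inr A B)).toMonoidHom

/-- Unfolding of `split`, first component. [folklore] -/
@[simp] theorem split_fst_apply (χ : PontryaginDual (A × B)) (a : A) : (split χ).1 a = χ (a, 1) := rfl

/-- Unfolding of `split`, second component. [folklore] -/
@[simp] theorem split_snd_apply (χ : PontryaginDual (A × B)) (b : B) : (split χ).2 b = χ (1, b) := rfl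

/-- **Gluing** `(φ, ψ) ↦ ((a, b) ↦ φ a * ψ b)` (`coprod`). [folklore] -/
def glue : PontryaginDual A × PontryaginDual B →* PontryaginDual (A × B) where
  toFun p := ContinuousMonoidHom.coprod p.1 p.2
  map_one' := by
    apply PontryaginDual.ext
    rintro ⟨a, b⟩
    change (1 : PontryaginDual A) a * (1 : PontryaginDual B) b = 1
    rw [PontryaginDual.one_apply, PontryaginDual.one_apply, one_mul]
  map_mul' p q := by
    apply PontryaginDual.ext
    rintro ⟨a, b⟩
    change (p.1 * q.1) a * ((p.2 * q.2) b) = (p.1 a * p.2 b) * (q.1 a * q.2 b)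
    change (p.1 a * q.1 a) * (p.2 b * q.2 b) = _
    rw [mul_mul_mul_comm]

/-- Unfolding of `glue`. [folklore] -/
@[simp] theorem glue_apply (φ : PontryaginDual A) (ψ : PontryaginDual B) (a : A) (b : B) :
    glue (φ, ψ) (a, b) = φ a * ψ b := rfl

/-- `glue ∘ split = id`. [folklore] -/
theorem glue_split (χ : PontryaginDual (A × B)) : glue (split χ) = χ := by
  apply PontryaginDual.ext
  rintro ⟨a, b⟩
  rw [apply_eq_mul χ a b]
  rfl

/-- `split ∘ glue = id`. [folklore] -/
theorem split_glue (p : PontryaginDual A × PontryaginDual B) : split (glue p) = p := by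
  obtain ⟨φ, ψ⟩ := p
  refine Prod.ext (PontryaginDual.ext fun a => ?_) (PontryaginDual.ext fun b => ?_)
  · change φ a * ψ 1 = φ a
    rw [map_one, mul_one]
  · change φ 1 * ψ b = ψ b
    rw [map_one, one_mul]

/-- **Deitmar–Echterhoff, Exercise 3.5**: `(A × B)^ ≅ Â × B̂` as groups, `χ ↦ (χ ∘ inl, χ ∘ inr)` with inverse
`(φ, ψ) ↦ ((a, b) ↦ φ a ψ b)`. [cite: DeitmarEchterhoff2014, Exercise 3.5] -/
def prodEquiv : PontryaginDual (A × B) ≃* PontryaginDual A × PontryaginDual B :=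
  { split with
    invFun := glue
    left_inv := glue_split
    right_inv := split_glue }

/-- Unfolding of `prodEquiv`, first component. [folklore] -/
@[simp] theorem prodEquiv_apply_fst (χ : PontryaginDual (A × B)) (a : A) :
    (prodEquiv χ).1 a = χ (a, 1) := rfl

/-- Unfolding of `prodEquiv`, second component. [folklore] -/
@[simp] theorem prodEquiv_apply_snd (χ : PontryaginDual (A × B)) (b : B) :
    (prodEquiv χ).2 b = χ (1, b) := rfl

/-- Unfolding of the inverse of `prodEquiv`. [folklore] -/
@[simp] theorem prodEquiv_symm_apply (φ : PontryaginDual A) (ψ : PontryaginDual B) (a : A) (b : B) :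
    (prodEquiv (A := A) (B := B)).symm (φ, ψ) (a, b) = φ a * ψ b := rfl

end ProdDual

end Literature.Topology.Algebra

end
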